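import Mathlib.Topology.MetricSpace.Sequences
import Summits.FinalStateConjecture.FinalStateConjecture.Theorems.PhaseMixingCaptureCaptureSufficesTameNoC0GenCone
import Literature.Geometry.Lorentzian.KerrSchild
import HarnessLib

/-!
# `CaptureSufficesTame` (stmt-FinalStateConjecture-17270), line `only-the-third-law-is-generic`: brick F2
# `stub_noC0_flatGenerators` — boundary points of a relative causal future of `ℝ⁴₁` are backward-lit until the
# vertex or the exit (Penrose's lemma on achronal boundaries, flat, relative to a bounded open set)

For `U ⊆ E4` open and bounded, `P ∈ U`, and `J = J(U, P)` the set of points of `U` reachable from `P` by a path inside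
`U`, differentiable on its parameter interval with future causal velocities (`η(v, v) ≤ 0 < v⁰`), the theorem
`stub_noC0_flatGenerators` (registered brick F2 of the lead's skeleton `CaptureSufficesTame.lean` §5, its statement
verbatim, with brick F1 `stub_noC0_flatBasics` verbatim as hypothesis) says: every `X ∈ U`, `X ≠ P`, with
`X ∈ closure J ∖ interior J` is the upper end of a backward null segment `X − s d`, `0 ≤ s < μ`, inside
`U ∩ (closure J ∖ interior J)`, which at `s = μ` reaches `P` or leaves `U`.

Proof (no limit curves, no Arzelà–Ascoli; only clause (i) PUSH-UP of F1 is used):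
* `gen_local` — at a boundary point `Y ≠ P` and every small scale `r` (`r < Y⁰ − P⁰`, `ball(Y, 2r) ⊆ U`) some
  backward null step `Y − r n` lands in `closure J`: `J`-points `Y_k → Y` are ends of causal paths from `P` crossing
  the slab `{x⁰ = Y⁰ − r}` at `J`-points `Z_k` with `Y_k − Z_k` future causal (cone mean value theorem); a
  subsequential limit `Z` (`U` bounded) has `Y − Z` future causal with time component `r`; timelike is excluded by
  push-up (`Y ∉ interior J`), so `Y − Z` is null;
* `gen_segment` (helper file) upgrades the step to a whole boundary segment `Y − s n`, `s ∈ [0, r]`;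
* maximal extension: `μ := sup {s | X − s' n ∈ U ∩ closure J ∖ interior J for all s' ≤ s}` is finite (`U` bounded)
  and positive; if `Q = X − μ n ∈ U` then `Q` is a boundary point, and if moreover `Q ≠ P` the local segment at `Q`
  has the same direction `n` — two non-parallel future null steps compose to a timelike chord inside the ball, and
  push-up from its lower end (in `closure J`) would put the boundary point `X − (μ − δ) n` into `interior J` — so the
  segment extends past `μ`, contradicting the supremum. Hence `Q = P` or `Q ∉ U`.

O'Neill 1983, Ch. 14, Cor. 14.27 (achronal boundaries are ruled by null geodesics) and Ch. 5 (timecones);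
Penrose 1972, §5; Hawking–Ellis 1973, Prop. 6.3.1.
-/

-- the doubled `FinalStateConjecture.FinalStateConjecture` path component trips dupNamespace (as in the skeleton)
set_option linter.dupNamespace false

noncomputable section

open scoped Topology
open Set Filter

namespace Summit.FinalStateConjecture.FinalStateConjecture.Theorems.PhaseMixingCaptureCaptureSufficesTame

open Literature.Geometry.Lorentzian

/-! ## The local step: a boundary point other than the vertex is backward-lit at every small scale -/

/-- **Local backward-lit lemma.** `U` bounded, `J = J(U, P)` the relative causal future with straight push-up, `Y` a
point of `closure J ∖ interior J`, and `0 < r < Y⁰ − P⁰` with `ball(Y, 2r) ⊆ U`. Then some future null `n` with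
`n⁰ = 1` has `Y − r n ∈ closure J`. Proof: `J`-points `Y_k → Y` are ends of causal paths from `P`, which cross the
slab `{x⁰ = Y⁰ − r}` at `J`-points `Z_k` with `Y_k − Z_k` future causal (cone mean value theorem); a subsequential
limit `Z` (boundedness) has `Y − Z` future causal with time component `r`, and `Y − Z` timelike would push `Y` into
`interior J`; so `Y − Z = r n` is null. (The limit-curve argument of Penrose's lemma, collapsed to one slab.)
O'Neill 1983, Ch. 14, Cor. 14.27; Hawking–Ellis 1973, Prop. 6.3.1. [cite: HawkingEllis1973, Prop. 6.3.1] -/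
theorem gen_local {U J : Set E4} {P : E4}
    (hJ : J = {Y | Y ∈ U ∧ (Y = P ∨ ∃ (γ : ℝ → E4) (a b : ℝ), a < b ∧ γ a = P ∧ γ b = Y ∧
      ∀ t ∈ Icc a b, γ t ∈ U ∧ ∃ v : E4, HasDerivAt γ v t ∧ Minkowski.bilin v v ≤ 0 ∧ 0 < v 0)})
    (hpush : ∀ A ∈ closure J, ∀ v : E4, Minkowski.bilin v v < 0 → 0 < v 0 →
      (∀ t ∈ Icc (0 : ℝ) 1, A + t • v ∈ U) → A + v ∈ interior J)
    (hUb : Bornology.IsBounded U) {Y : E4} {r : ℝ} (hYcl : Y ∈ closure J) (hYint : Y ∉ interior J)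
    (hr : 0 < r) (hrY : r < Y 0 - P 0) (hball : Metric.ball Y (2 * r) ⊆ U) :
    ∃ n : E4, n 0 = 1 ∧ Minkowski.bilin n n = 0 ∧ Y - r • n ∈ closure J := by
  have hc0 : Continuous fun Z : E4 ↦ Z 0 := by fun_prop
  -- `J`-points converging to `Y`, eventually later than the slab `x⁰ = Y⁰ - r`
  obtain ⟨y, hyJ, hyT⟩ := mem_closure_iff_seq_limit.1 hYcl
  obtain ⟨k₀, hk₀⟩ : ∃ k₀, ∀ k ≥ k₀, Y 0 - r < y k 0 :=
    eventually_atTop.1 (((hc0.tendsto Y).comp hyT).eventually (lt_mem_nhds (by linarith)))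
  -- for each `k`, a `J`-point `Z` on the slab with `y (k + k₀) - Z` future causal
  have hZex : ∀ k, ∃ Z ∈ J, Z 0 = Y 0 - r ∧
      Minkowski.bilin (y (k + k₀) - Z) (y (k + k₀) - Z) ≤ 0 := by
    intro k
    have hyk := hyJ (k + k₀)
    have hlt := hk₀ (k + k₀) (Nat.le_add_left k₀ k)
    rw [hJ] at hyk
    obtain ⟨-, hyP | ⟨γ, a, b, hab, hγa, hγb, hγ⟩⟩ := hyk
    · rw [hyP] at hlt
      linarith
    · have hcont : ContinuousOn (fun t ↦ γ t 0) (Icc a b) := by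
        intro t ht
        obtain ⟨-, v, hv, -, -⟩ := hγ t ht
        exact (hc0.continuousAt.comp hv.continuousAt).continuousWithinAt
      have hmem : Y 0 - r ∈ Icc (γ a 0) (γ b 0) := by
        rw [hγa, hγb]
        exact ⟨by linarith, hlt.le⟩
      obtain ⟨t₀, ht₀, hγt₀⟩ : ∃ t₀ ∈ Icc a b, γ t₀ 0 = Y 0 - r := intermediate_value_Icc hab.le hcont hmem
      refine ⟨γ t₀, ?_, hγt₀, ?_⟩
      · rw [hJ]
        refine ⟨(hγ t₀ ht₀).1, Or.inr ⟨γ, a, t₀, lt_of_le_of_ne ht₀.1 ?_, hγa, rfl,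
          fun t ht ↦ hγ t ⟨ht.1, ht.2.trans ht₀.2⟩⟩⟩
        rintro rfl
        rw [hγa] at hγt₀
        linarith
      · have h := gen_cone_mvt ht₀.2 fun t ht ↦ (hγ t ⟨ht₀.1.trans ht.1, ht.2⟩).2
        rw [hγb] at h
        exact h.1
  choose Z hZJ hZ0 hZc using hZex
  -- a convergent subsequence of the slab points (`U` is bounded)
  have hJU : J ⊆ U := by
    rw [hJ]
    exact fun _ h ↦ h.1
  obtain ⟨Zi, -, φ, hφ, hZT⟩ := tendsto_subseq_of_bounded hUb fun k ↦ hJU (hZJ k)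
  have hZT' : Tendsto (fun k ↦ Z (φ k)) atTop (𝓝 Zi) := hZT
  have hyT' : Tendsto (fun k ↦ y (φ k + k₀)) atTop (𝓝 Y) :=
    ((tendsto_add_atTop_iff_nat k₀).2 hyT).comp hφ.tendsto_atTop
  have hwT : Tendsto (fun k ↦ y (φ k + k₀) - Z (φ k)) atTop (𝓝 (Y - Zi)) := hyT'.sub hZT'
  -- the limit displacement `Y - Zi` is future causal with time component `r`
  have hcb : Continuous fun w : E4 ↦ Minkowski.bilin w w := by
    simp only [Minkowski.bilin_apply]
    fun_prop
  have hwc : Minkowski.bilin (Y - Zi) (Y - Zi) ≤ 0 :=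
    le_of_tendsto' ((hcb.tendsto _).comp hwT) fun k ↦ hZc (φ k)
  have hZi0 : Zi 0 = Y 0 - r := by
    refine tendsto_nhds_unique ((hc0.tendsto _).comp hZT') ?_
    have : (fun k ↦ Z (φ k) 0) = fun _ ↦ Y 0 - r := funext fun k ↦ hZ0 (φ k)
    simp only [Function.comp_def, this]
    exact tendsto_const_nhds
  have hw0 : (Y - Zi) 0 = r := by
    simp only [PiLp.sub_apply, hZi0]
    ring
  have hZicl : Zi ∈ closure J :=
    isClosed_closure.mem_of_tendsto hZT' (Eventually.of_forall fun k ↦ subset_closure (hZJ (φ k)))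
  have hwn : ‖Y - Zi‖ < 2 * r := by
    have h1 := gen_norm_sq_le_of_causal hwc
    rw [hw0] at h1
    exact lt_of_pow_lt_pow_left₀ 2 (by positivity) (by nlinarith)
  rcases hwc.lt_or_eq with hlt | heq
  · -- timelike limit displacement: push-up from `Zi` reaches `Y`, contradiction
    exfalso
    apply hYint
    have key := hpush Zi hZicl (Y - Zi) hlt (by rw [hw0]; exact hr) ?_
    · simpa using key
    · intro t ht
      apply hball
      rw [mem_ball_iff_norm]
      have : Zi + t • (Y - Zi) - Y = (t - 1) • (Y - Zi) := by module
      rw [this, norm_smul, Real.norm_eq_abs, abs_of_nonpos (by linarith [ht.2])]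
      calc -(t - 1) * ‖Y - Zi‖ ≤ 1 * ‖Y - Zi‖ := by gcongr; linarith [ht.1]
        _ < 2 * r := by rw [one_mul]; exact hwn
  · -- null limit displacement: the direction `n = r⁻¹ (Y - Zi)`
    refine ⟨r⁻¹ • (Y - Zi), ?_, ?_, ?_⟩
    · rw [PiLp.smul_apply, hw0, smul_eq_mul, inv_mul_cancel₀ hr.ne']
    · simp only [Minkowski.bilin_apply, PiLp.smul_apply, smul_eq_mul, Fin.sum_univ_three] at heq ⊢
      linear_combination (r⁻¹ * r⁻¹) * heq
    · rw [smul_smul, mul_inv_cancel₀ hr.ne', one_smul, sub_sub_cancel]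
      exact hZicl

/-! ## Brick F2: boundary points of `J(U, P)` are backward-lit until the vertex or the exit -/

/-- **Brick F2 `stub_noC0_flatGenerators` — BOUNDARY POINTS OF A RELATIVE CAUSAL FUTURE ARE BACKWARD-LIT UNTIL THE
VERTEX OR THE EXIT** (Penrose's lemma on achronal boundaries, for `ℝ⁴₁` relative to a bounded open set), GRANTED
brick F1 (its statement verbatim as the hypothesis; only its push-up clause (i) is used). For `U ⊆ E4` open and
bounded, `P ∈ U`, `J = J(U, P)`, and a point `X ∈ U`, `X ≠ P`, of `closure J ∖ interior J`: there are a future null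
direction `d` and `μ > 0` such that the backward null segment `X − λ d`, `0 ≤ λ < μ`, stays in
`U ∩ (closure J ∖ interior J)`, and at `λ = μ` it either reaches the vertex `P` or leaves `U`. Proof: at every boundary
point `Y ≠ P` there is a backward null boundary segment `Y − s n`, `0 ≤ s ≤ r` (`gen_local` — one-slab limit-curve
argument — plus `gen_segment`); starting at `X`, let `μ` be the supremum of the `s` up to which `X − s n` stays in
`U ∩ (closure J ∖ interior J)` (finite since `U` is bounded). If `Q = X − μ n ∈ U`, then `Q` is a boundary point, and if
`Q ≠ P` the local segment at `Q` has the SAME direction `n` (two non-parallel null steps compose to a timelike chord, and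
push-up would put a boundary point into `interior J`), so the segment extends beyond `μ` — contradiction; hence
`Q = P` or `Q ∉ U`. O'Neill 1983, Ch. 14, Cor. 14.27 and Prop. 10.46 (flat case); Penrose 1972, §5; Hawking–Ellis 1973,
Prop. 6.3.1. [cite: ONeill1983, Ch. 14, Cor. 14.27] [cite: HawkingEllis1973, Prop. 6.3.1] -/
theorem stub_noC0_flatGenerators :
    (∀ (U : Set E4), IsOpen U → ∀ P ∈ U, ∀ J : Set E4,
      J = {Y | Y ∈ U ∧ (Y = P ∨ ∃ (γ : ℝ → E4) (a b : ℝ), a < b ∧ γ a = P ∧ γ b = Y ∧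
            ∀ t ∈ Set.Icc a b, γ t ∈ U ∧ ∃ v : E4, HasDerivAt γ v t ∧ Minkowski.bilin v v ≤ 0 ∧ 0 < v 0)} →
      (∀ A B : E4, A ∈ U → B ∈ U → A ∈ closure J →
        (∃ (γ : ℝ → E4) (a b : ℝ), a < b ∧ γ a = A ∧ γ b = B ∧
            ∀ t ∈ Set.Icc a b, γ t ∈ U ∧ ∃ v : E4, HasDerivAt γ v t ∧ Minkowski.bilin v v < 0 ∧ 0 < v 0) →
        B ∈ interior J) ∧
      (∀ d : E4, Minkowski.bilin d d = 0 → 0 < d 0 → ∀ l₀ : ℝ, 0 ≤ l₀ →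
        (∀ s ∈ Set.Icc 0 l₀, P + s • d ∈ U) →
        ∀ s ∈ Set.Icc 0 l₀, P + s • d ∈ closure J ∧ P + s • d ∉ interior J)) →
    ∀ (U : Set E4), IsOpen U → Bornology.IsBounded U → ∀ P ∈ U, ∀ J : Set E4,
      J = {Y | Y ∈ U ∧ (Y = P ∨ ∃ (γ : ℝ → E4) (a b : ℝ), a < b ∧ γ a = P ∧ γ b = Y ∧
            ∀ t ∈ Set.Icc a b, γ t ∈ U ∧ ∃ v : E4, HasDerivAt γ v t ∧ Minkowski.bilin v v ≤ 0 ∧ 0 < v 0)} →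
      ∀ X ∈ U, X ∈ closure J → X ∉ interior J → X ≠ P →
        ∃ d : E4, Minkowski.bilin d d = 0 ∧ 0 < d 0 ∧ ∃ μ : ℝ, 0 < μ ∧
          (∀ s ∈ Set.Ico 0 μ, X - s • d ∈ U ∧ X - s • d ∈ closure J ∧ X - s • d ∉ interior J) ∧
          (X - μ • d = P ∨ X - μ • d ∉ U) := by
  intro hF U hU hUb P hP J hJ X hXU hXcl hXint hXP
  have hpush : ∀ A ∈ closure J, ∀ v : E4, Minkowski.bilin v v < 0 → 0 < v 0 →
      (∀ t ∈ Icc (0 : ℝ) 1, A + t • v ∈ U) → A + v ∈ interior J :=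
    fun A hA v hvv hv0 hseg ↦ gen_pushup_straight (hF U hU P hP J hJ).1 hA hvv hv0 hseg
  have hJ' : ∀ Y ∈ J, Y = P ∨ ∃ (γ : ℝ → E4) (a b : ℝ), a < b ∧ γ a = P ∧ γ b = Y ∧
      ∀ t ∈ Icc a b, ∃ v : E4, HasDerivAt γ v t ∧ Minkowski.bilin v v ≤ 0 ∧ 0 < v 0 := by
    intro Y hY
    rw [hJ] at hY
    rcases hY.2 with h | ⟨γ, a, b, hab, h1, h2, h3⟩
    · exact Or.inl h
    · exact Or.inr ⟨γ, a, b, hab, h1, h2, fun t ht ↦ (h3 t ht).2⟩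
  -- the local step: at a boundary point `Y ≠ P` of `J` in `U`, a backward null boundary segment
  have hstep : ∀ Y ∈ U, Y ∈ closure J → Y ∉ interior J → Y ≠ P →
      ∃ n : E4, n 0 = 1 ∧ Minkowski.bilin n n = 0 ∧ ∃ r : ℝ, 0 < r ∧ Metric.ball Y (2 * r) ⊆ U ∧
        ∀ s ∈ Icc 0 r, Y - s • n ∈ U ∧ Y - s • n ∈ closure J ∧ Y - s • n ∉ interior J := by
    intro Y hYU hYcl hYint hYP
    have hT := gen_time_lt_of_mem_closure hJ' hYcl hYP
    obtain ⟨ρ, hρ, hρU⟩ := Metric.isOpen_iff.1 hU Y hYU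
    obtain ⟨r, hr0, hrρ, hrT⟩ : ∃ r : ℝ, 0 < r ∧ 2 * r ≤ ρ ∧ r < Y 0 - P 0 :=
      ⟨min (ρ / 2) ((Y 0 - P 0) / 2), lt_min (half_pos hρ) (half_pos (sub_pos.2 hT)),
        by linarith [min_le_left (ρ / 2) ((Y 0 - P 0) / 2)],
        (min_le_right _ _).trans_lt (half_lt_self (sub_pos.2 hT))⟩
    have hball : Metric.ball Y (2 * r) ⊆ U := (Metric.ball_subset_ball hrρ).trans hρU
    obtain ⟨n, hn0, hnn, hZ⟩ := gen_local hJ hpush hUb hYcl hYint hr0 hrT hball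
    exact ⟨n, hn0, hnn, r, hr0, hball, gen_segment U J hpush Y n r hYint hn0 hnn hr0 hball hZ⟩
  -- the generator through `X` and its maximal backward extension inside `U`
  obtain ⟨n, hn0, hnn, r₀, hr₀, -, hseg₀⟩ := hstep X hXU hXcl hXint hXP
  set S : Set ℝ := {s | 0 ≤ s ∧ ∀ s' ∈ Icc 0 s,
    X - s' • n ∈ U ∧ X - s' • n ∈ closure J ∧ X - s' • n ∉ interior J} with hS
  have hr₀S : r₀ ∈ S := ⟨hr₀.le, hseg₀⟩
  have hSne : S.Nonempty := ⟨r₀, hr₀S⟩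
  obtain ⟨R, hR⟩ := hUb.subset_ball X
  have hn1 := gen_one_le_norm_of_null hn0 hnn
  have hn15 := gen_norm_le_of_null hn0 hnn
  have hSbdd : BddAbove S := by
    refine ⟨R, fun s hs ↦ ?_⟩
    have h1 := hR (hs.2 s ⟨hs.1, le_rfl⟩).1
    rw [mem_ball_iff_norm, sub_sub_cancel_left, norm_neg, norm_smul, Real.norm_eq_abs, abs_of_nonneg hs.1] at h1
    nlinarith [hs.1]
  have hr₀μ : r₀ ≤ sSup S := le_csSup hSbdd hr₀S
  have hμ0 : 0 < sSup S := hr₀.trans_le hr₀μ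
  have hgood : ∀ s ∈ Ico 0 (sSup S), X - s • n ∈ U ∧ X - s • n ∈ closure J ∧ X - s • n ∉ interior J := by
    intro s hs
    obtain ⟨s₁, hs₁, hss₁⟩ := exists_lt_of_lt_csSup hSne hs.2
    exact hs₁.2 s ⟨hs.1, hss₁.le⟩
  refine ⟨n, hnn, by rw [hn0]; exact one_pos, sSup S, hμ0, hgood, ?_⟩
  by_cases hQU : X - sSup S • n ∈ U
  swap
  · exact Or.inr hQU
  left
  by_contra hQP
  -- `Q = X - μ n ∈ U` is a boundary point of `J` other than `P`
  have hQcl : X - sSup S • n ∈ closure J := by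
    have ht : Tendsto (fun s : ℝ ↦ X - s • n) (𝓝[<] sSup S) (𝓝 (X - sSup S • n)) :=
      ((by fun_prop : Continuous fun s : ℝ ↦ X - s • n).tendsto (sSup S)).mono_left nhdsWithin_le_nhds
    refine isClosed_closure.mem_of_tendsto ht ?_
    filter_upwards [Ico_mem_nhdsLT hμ0] with s hs using (hgood s hs).2.1
  have hQint : X - sSup S • n ∉ interior J := by
    intro hQ
    obtain ⟨ε, hε, hεball⟩ := Metric.isOpen_iff.1 isOpen_interior _ hQ
    obtain ⟨t, ht0, htμ, htε⟩ : ∃ t : ℝ, 0 < t ∧ t < sSup S ∧ t ≤ ε / 2 :=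
      ⟨min (sSup S / 2) (ε / 2), lt_min (half_pos hμ0) (half_pos hε),
        (min_le_left _ _).trans_lt (half_lt_self hμ0), min_le_right _ _⟩
    refine (hgood (sSup S - t) ⟨by linarith, by linarith⟩).2.2 (hεball ?_)
    rw [mem_ball_iff_norm]
    have : X - (sSup S - t) • n - (X - sSup S • n) = t • n := by module
    rw [this, norm_smul, Real.norm_eq_abs, abs_of_pos ht0]
    nlinarith
  obtain ⟨m, hm0, hmm, r, hr, hballQ, hsegQ⟩ := hstep (X - sSup S • n) hQU hQcl hQint hQP
  -- the direction at `Q` is again `n` (two non-parallel null steps compose to a timelike chord)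
  have hmn : m = n := by
    by_contra hmn
    obtain ⟨δ, hδ0, hδr, hδμ⟩ : ∃ δ : ℝ, 0 < δ ∧ δ ≤ r ∧ δ < sSup S :=
      ⟨min r (sSup S / 2), lt_min hr (half_pos hμ0), min_le_left _ _,
        (min_le_right _ _).trans_lt (half_lt_self hμ0)⟩
    refine (hgood (sSup S - δ) ⟨by linarith, by linarith⟩).2.2 ?_
    have hW : X - sSup S • n - r • m ∈ closure J := (hsegQ r ⟨hr.le, le_rfl⟩).2.1
    have hv := gen_bilin_add_lt_zero_of_null_ne hm0 hmm hn0 hnn hmn hr hδ0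
    have key := hpush _ hW (r • m + δ • n) hv.1 hv.2 ?_
    · convert key using 1
      module
    · intro t ht
      apply hballQ
      rw [mem_ball_iff_norm]
      have : X - sSup S • n - r • m + t • (r • m + δ • n) - (X - sSup S • n) =
          (t * δ) • n + (-((1 - t) * r)) • m := by module
      rw [this]
      have h1 : ‖(t * δ) • n‖ ≤ t * r * (3 / 2) := by
        rw [norm_smul, Real.norm_eq_abs, abs_of_nonneg (by nlinarith [ht.1])]
        exact mul_le_mul (by nlinarith [ht.1]) hn15 (norm_nonneg _) (by nlinarith [ht.1])
      have h2 : ‖(-((1 - t) * r)) • m‖ ≤ (1 - t) * r * (3 / 2) := by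
        rw [norm_smul, Real.norm_eq_abs, abs_neg, abs_of_nonneg (by nlinarith [ht.2])]
        exact mul_le_mul_of_nonneg_left (gen_norm_le_of_null hm0 hmm) (by nlinarith [ht.2])
      calc ‖(t * δ) • n + (-((1 - t) * r)) • m‖ ≤ ‖(t * δ) • n‖ + ‖(-((1 - t) * r)) • m‖ := norm_add_le _ _
        _ < 2 * r := by linarith
  rw [hmn] at hsegQ
  -- the boundary segment extends beyond `μ = sSup S`: contradiction
  have hext : sSup S + r ∈ S := by
    refine ⟨by linarith, fun s' hs' ↦ ?_⟩
    rcases lt_or_ge s' (sSup S) with h | h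
    · exact hgood s' ⟨hs'.1, h⟩
    · have h2 := hsegQ (s' - sSup S) ⟨by linarith, by linarith [hs'.2]⟩
      have : X - sSup S • n - (s' - sSup S) • n = X - s' • n := by module
      rwa [this] at h2
  have := le_csSup hSbdd hext
  linarith

end Summit.FinalStateConjecture.FinalStateConjecture.Theorems.PhaseMixingCaptureCaptureSufficesTame

end
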